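import Summits.AtomisticToContinuum.Crystallization.Theorems.StackingFaultSparsity.Negative.HcpShellCensus
import Summits.AtomisticToContinuum.Crystallization.Theorems.ThreeConeCertificateSlackRigidityLayeringIdeal

/-!
# `StackingFaultSparsity` (stmt-AtomisticToContinuum-14296), negative side V: the cuboctahedral cluster is counted

Part V of the refuter's negative-side lemmas (I `HcpTwin`, II `BarlowWindow`, III `DimerGas`,
IV `HcpShellCensus`).

* `fccPos`, `fccQ`, `dist_fccPos_sq` — in stacking coordinates the ideal fcc lattice
  `fccStacking 1 √(2/3)` has squared distances `fccQ(Δk, Δi, Δj) = Δk² + Δi² + Δj² + ΔkΔi + ΔkΔj + ΔiΔj`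
  (the `A₃` root form): integral, so distinct points are `≥ 1` apart (`one_le_dist_fccPos`), and the
  points within `1` of a site are the site and the twelve roots (`mem_D13_of_fccQ_le_one`); fcc is
  centrosymmetric (`fccPos_neg`).
* `cuboConfig` — the ideal 13-particle cuboctahedral cluster (a site and its fcc first shell);
  `barlowMatched_cuboConfig` (exactly matched to `fccStacking 1 √(2/3)` at `R = 1`),
  `not_hcpMatched_cuboConfig` (by `not_hcpMatched_of_symmetric_shell`), packaged as
  `cuboConfig_centre_counted`.
* READING FOR THE CRUX.  At `(R, ε) = (1, 1/100)` the counted set of `StackingFaultSparsity` contains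
  every (unit-scaled) fcc-coordinated site; for ground states the crux therefore asserts in particular
  that cuboctahedral coordination has density `→ 0` in Lennard-Jones ground states — stacking selection
  proper (hcp over fcc, numerically `7.25e-5` per particle, Stillinger 2001), which no potential-free
  argument supplies (cf. `stackingFaultSparsity_false_without_groundState`, part III).
-/

noncomputable section

namespace Summit.AtomisticToContinuum.Crystallization.Theorems.StackingFaultSparsityNegative

open Literature.MathematicalPhysics.StatisticalMechanics
open Summit.AtomisticToContinuum.Crystallization.Theorems.CLayerWitnessLayeringIdeal (barlowPos_zero_zero_zero)

/-! ### The fcc side: the ideal cuboctahedral cluster -/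

/-- Ideal layer spacing `h₀ = √(2/3)` for in-layer spacing `1`. -/
def h₀ : ℝ := √(2 / 3)

/-- `h₀² = 2/3`. [folklore] -/
theorem h₀_sq : h₀ ^ 2 = 2 / 3 := Real.sq_sqrt (by norm_num)

/-- `h₀ > 1/2` (it is `≈ 0.8165`). [folklore] -/
theorem half_lt_h₀ : 1 / 2 < h₀ := by
  rw [h₀, show (1 / 2 : ℝ) = √(1 / 4) by
    rw [show (1 / 4 : ℝ) = (1 / 2) ^ 2 by norm_num, Real.sqrt_sq (by norm_num)]]
  exact Real.sqrt_lt_sqrt (by norm_num) (by norm_num)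

/-- `h₀ < 2`. [folklore] -/
theorem h₀_lt_two : h₀ < 2 := by
  rw [h₀, show (2 : ℝ) = √4 by
    rw [show (4 : ℝ) = 2 ^ 2 by norm_num, Real.sqrt_sq (by norm_num)]]
  exact Real.sqrt_lt_sqrt (by norm_num) (by norm_num)

/-- Points of the ideal fcc lattice `fccStacking 1 h₀` (nearest-neighbour distance `1`). -/
def fccPos (k i j : ℤ) : E3 := barlowPos 1 h₀ constHagg k i j

/-- The fcc quadratic form (the `A₃` root form in stacking coordinates). -/
def fccQ (x y z : ℤ) : ℤ := x ^ 2 + y ^ 2 + z ^ 2 + x * y + x * z + y * z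

/-- **Squared fcc distances are values of the integral form `fccQ`.** -/
theorem dist_fccPos_sq (k i j k' i' j' : ℤ) :
    dist (fccPos k i j) (fccPos k' i' j') ^ 2 = (fccQ (k - k') (i - i') (j - j') : ℤ) := by
  rw [fccPos, fccPos, dist_barlowPos_pair_sq, haggLabel_const, haggLabel_const, mul_pow, h₀_sq, fccQ]
  push_cast
  ring

/-- Distinct fcc points are at distance `≥ 1`. -/
theorem one_le_dist_fccPos {k i j k' i' j' : ℤ} (hne : fccPos k i j ≠ fccPos k' i' j') :
    1 ≤ dist (fccPos k i j) (fccPos k' i' j') := by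
  have hsq := dist_fccPos_sq k i j k' i' j'
  have hpos : 0 < dist (fccPos k i j) (fccPos k' i' j') := dist_pos.mpr hne
  have hQpos : (0 : ℝ) < (fccQ (k - k') (i - i') (j - j') : ℤ) := by rw [← hsq]; positivity
  have hQ1 : (1 : ℤ) ≤ fccQ (k - k') (i - i') (j - j') := by
    have : (0 : ℤ) < fccQ (k - k') (i - i') (j - j') := by exact_mod_cast hQpos
    omega
  have hQ1' : (1 : ℝ) ≤ (fccQ (k - k') (i - i') (j - j') : ℤ) := by exact_mod_cast hQ1
  nlinarith

/-- fcc is centrosymmetric about each site: `fccPos (-k) (-i) (-j) = - fccPos k i j`. -/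
theorem fccPos_neg (k i j : ℤ) : fccPos (-k) (-i) (-j) = -fccPos k i j := by
  ext l
  fin_cases l <;> simp [fccPos] <;> ring

/-- The origin (an instance of `barlowPos_zero_zero_zero`). [folklore] -/
theorem fccPos_zero : fccPos 0 0 0 = 0 := barlowPos_zero_zero_zero 1 h₀ constHagg

/-- The origin and the twelve roots: stacking coordinates `(k, i, j)` of the cuboctahedral cluster. -/
def D13 : Finset (ℤ × ℤ × ℤ) :=
  {(0, 0, 0), (0, 1, 0), (0, 0, 1), (0, -1, 0), (0, 0, -1), (0, 1, -1), (0, -1, 1),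
    (1, 0, 0), (1, -1, 0), (1, 0, -1), (-1, 0, 0), (-1, 1, 0), (-1, 0, 1)}

/-- **fcc census at radius `1`:** `fccQ ≤ 1` only at the origin and the twelve roots. -/
theorem mem_D13_of_fccQ_le_one {x y z : ℤ} (hQ : fccQ x y z ≤ 1) : (x, y, z) ∈ D13 := by
  have h2 : 2 * fccQ x y z = x ^ 2 + y ^ 2 + z ^ 2 + (x + y + z) ^ 2 := by rw [fccQ]; ring
  have hx : x ^ 2 ≤ 2 := by nlinarith [sq_nonneg y, sq_nonneg z, sq_nonneg (x + y + z)]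
  have hy : y ^ 2 ≤ 2 := by nlinarith [sq_nonneg x, sq_nonneg z, sq_nonneg (x + y + z)]
  have hz : z ^ 2 ≤ 2 := by nlinarith [sq_nonneg y, sq_nonneg x, sq_nonneg (x + y + z)]
  have hx1 : x ^ 2 < 2 ^ 2 := by linarith
  have hy1 : y ^ 2 < 2 ^ 2 := by linarith
  have hz1 : z ^ 2 < 2 ^ 2 := by linarith
  obtain ⟨hxa, hxb⟩ := abs_lt_of_sq_lt_sq' hx1 (by norm_num)
  obtain ⟨hya, hyb⟩ := abs_lt_of_sq_lt_sq' hy1 (by norm_num)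
  obtain ⟨hza, hzb⟩ := abs_lt_of_sq_lt_sq' hz1 (by norm_num)
  have hQ' : x * x + y * y + z * z + x * y + x * z + y * z ≤ 1 := by rw [fccQ] at hQ; linarith
  clear hQ h2 hx hy hz hx1 hy1 hz1
  interval_cases x <;> interval_cases y <;> interval_cases z <;> first | omega | decide

/-- The cluster coordinates as a table. -/
def cuboIdx : Fin 13 → ℤ × ℤ × ℤ :=
  ![(0, 0, 0), (0, 1, 0), (0, 0, 1), (0, -1, 0), (0, 0, -1), (0, 1, -1), (0, -1, 1),
    (1, 0, 0), (1, -1, 0), (1, 0, -1), (-1, 0, 0), (-1, 1, 0), (-1, 0, 1)]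

/-- The table `cuboIdx` enumerates `D13`. [folklore] -/
theorem exists_cuboIdx_eq : ∀ t ∈ D13, ∃ n : Fin 13, cuboIdx n = t := by decide

/-- The twelve shell sites are roots: `fccQ = 1`. [folklore] -/
theorem fccQ_cuboIdx : ∀ n : Fin 13, n ≠ 0 →
    fccQ (cuboIdx n).1 (cuboIdx n).2.1 (cuboIdx n).2.2 = 1 := by decide

/-- Distinct cluster sites differ by a vector with `fccQ ≥ 1`. [folklore] -/
theorem fccQ_cuboIdx_sub : ∀ n n' : Fin 13, n ≠ n' →
    1 ≤ fccQ ((cuboIdx n).1 - (cuboIdx n').1) ((cuboIdx n).2.1 - (cuboIdx n').2.1)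
      ((cuboIdx n).2.2 - (cuboIdx n').2.2) := by decide

/-- The shell is closed under inversion through the centre. [folklore] -/
theorem cuboIdx_symm : ∀ n : Fin 13, n ≠ 0 → ∃ n' : Fin 13, n' ≠ 0 ∧
    cuboIdx n' = (-(cuboIdx n).1, -(cuboIdx n).2.1, -(cuboIdx n).2.2) := by decide

/-- Site `0` is the centre. [folklore] -/
theorem cuboIdx_zero : cuboIdx 0 = (0, 0, 0) := rfl

/-- **The ideal cuboctahedral cluster**: a centre and its twelve fcc nearest neighbours at distance
`1` (the first coordination shell of the face-centred cubic packing). -/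
def cuboConfig : Fin 13 → E3 := fun n => fccPos (cuboIdx n).1 (cuboIdx n).2.1 (cuboIdx n).2.2

/-- The centre sits at the origin. [folklore] -/
theorem cuboConfig_zero : cuboConfig 0 = 0 := by
  simp only [cuboConfig, cuboIdx_zero]; exact fccPos_zero

/-- The twelve shell particles are at distance exactly `1` from the centre. [folklore] -/
theorem dist_cuboConfig_zero {n : Fin 13} (hn : n ≠ 0) : dist (cuboConfig n) (cuboConfig 0) = 1 := by
  have hsq : dist (cuboConfig n) (cuboConfig 0) ^ 2 = 1 := by
    simp only [cuboConfig, cuboIdx_zero]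
    rw [dist_fccPos_sq]
    simp only [sub_zero]
    exact_mod_cast fccQ_cuboIdx n hn
  nlinarith [dist_nonneg (x := cuboConfig n) (y := cuboConfig 0)]

/-- **The centre of the cuboctahedral cluster is Barlow-matched** at `(R, ε) = (1, 1/100)` (indeed
exactly, to `fccStacking 1 h₀`). -/
theorem barlowMatched_cuboConfig : BarlowMatched 1 (1 / 100) cuboConfig 0 := by
  refine ⟨1, h₀, by norm_num, by norm_num, half_lt_h₀, h₀_lt_two, constHagg, isHaggSeq_const,
    fccPos 0 0 0, barlowPos_mem _ _ _, LinearIsometry.id, ?_, ?_⟩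
  · rintro p ⟨k, i, j, rfl⟩ hpd
    have hpd' : dist (fccPos k i j) (fccPos 0 0 0) ≤ 1 := hpd
    have hQ : fccQ k i j ≤ 1 := by
      have hsq := dist_fccPos_sq k i j 0 0 0
      simp only [sub_zero] at hsq
      have h2 : dist (fccPos k i j) (fccPos 0 0 0) ^ 2 ≤ 1 := by
        have h0 : (0 : ℝ) ≤ dist (fccPos k i j) (fccPos 0 0 0) := dist_nonneg
        nlinarith
      have : ((fccQ k i j : ℤ) : ℝ) ≤ 1 := by rw [← hsq]; exact h2
      exact_mod_cast this
    obtain ⟨n, hn⟩ := exists_cuboIdx_eq _ (mem_D13_of_fccQ_le_one hQ)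
    refine ⟨n, ?_⟩
    have : cuboConfig n = fccPos k i j := by
      simp only [cuboConfig, hn]
    rw [this, cuboConfig_zero, fccPos_zero]
    simp [fccPos]
  · intro n _
    refine ⟨cuboConfig n, barlowPos_mem _ _ _, ?_⟩
    rw [cuboConfig_zero, fccPos_zero]
    simp

/-- **… and it is not hcp-matched** there: the cuboctahedron (fcc first shell) is congruent to no
`1`-window of any relaxed hcp `hcpStacking a h`, `a, h ∈ (1/2, 2)`, at tolerance `1/100`. -/
theorem not_hcpMatched_cuboConfig : ¬ HcpMatched 1 (1 / 100) cuboConfig 0 := by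
  refine not_hcpMatched_of_symmetric_shell cuboConfig 0 (Finset.univ.filter (· ≠ 0)) (by decide)
    (fun n hn => dist_cuboConfig_zero (Finset.mem_filter.mp hn).2) ?_ ?_ ?_
  · intro n hn n' hn' hne
    simp only [cuboConfig]
    have hsq := dist_fccPos_sq (cuboIdx n).1 (cuboIdx n).2.1 (cuboIdx n).2.2
      (cuboIdx n').1 (cuboIdx n').2.1 (cuboIdx n').2.2
    have h1 : (1 : ℝ) ≤ (fccQ ((cuboIdx n).1 - (cuboIdx n').1) ((cuboIdx n).2.1 - (cuboIdx n').2.1)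
      ((cuboIdx n).2.2 - (cuboIdx n').2.2) : ℤ) := by exact_mod_cast fccQ_cuboIdx_sub n n' hne
    rw [← hsq] at h1
    nlinarith [dist_nonneg (x := fccPos (cuboIdx n).1 (cuboIdx n).2.1 (cuboIdx n).2.2)
      (y := fccPos (cuboIdx n').1 (cuboIdx n').2.1 (cuboIdx n').2.2)]
  · intro n hn
    obtain ⟨n', hn'0, hn'⟩ := cuboIdx_symm n (Finset.mem_filter.mp hn).2
    refine ⟨n', Finset.mem_filter.mpr ⟨Finset.mem_univ _, hn'0⟩, ?_⟩
    rw [cuboConfig_zero, sub_zero, sub_zero]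
    simp only [cuboConfig, hn']
    exact fccPos_neg _ _ _
  · intro n hn
    by_contra hne
    have h0 : n ≠ 0 := fun h0 => hne (by rw [h0])
    rw [dist_cuboConfig_zero h0] at hn
    exact lt_irrefl _ hn

/-- **The cuboctahedral (fcc) coordination is counted by the crux.** At `(R, ε) = (1, 1/100)` the
centre of the ideal 13-particle cuboctahedral cluster is Barlow-matched and not hcp-matched.  Read
contrapositively for ground states: `StackingFaultSparsity` at `(1, 1/100)` asserts in particular that
(exactly scaled) fcc-coordinated sites have density `→ 0` in Lennard-Jones ground states — the
stacking-selection content that only the energetics can supply. -/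
theorem cuboConfig_centre_counted :
    BarlowMatched 1 (1 / 100) cuboConfig 0 ∧ ¬ HcpMatched 1 (1 / 100) cuboConfig 0 :=
  ⟨barlowMatched_cuboConfig, not_hcpMatched_cuboConfig⟩

end Summit.AtomisticToContinuum.Crystallization.Theorems.StackingFaultSparsityNegative

end
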